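import Mathlib
import HarnessLib
import Literature.MathematicalPhysics.StatisticalMechanics.TorusPolymers
import Literature.MathematicalPhysics.StatisticalMechanics.TorusNeighbourhoods

/-!
# Blocks of the torus paving: cardinality, diameter, block centres; polymers as unions of
# blocks (Adams–Kotecký–Müller Ch. 4 / Adams–Buchholz–Kotecký–Müller Ch. 6.2)

`TorusPolymers.lean` paves the torus `(ℤ/M)^d` by the centred cubes of odd side `s`
(`blockOf s x`, `cubeIndex`, `IsPolymer`, `numBlocks`).  For the weights and norms of [ABKM19]
(Ch. 7: `χ_X = Σ_{B∈𝓑_k(X)} 1_{B⁺}`, `|X|_k`; Lemma 7.7: `|X^{+++}| ≤ (7R+1)^d L^{kd}|X|_k`; Lemma 7.8: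
`X* = ⋃_B B*`) one needs the METRIC facts of this paving when the side divides the torus evenly,
`M = s·t` with `s`, `t` odd (in the source `M = L^N`, `s = L^k`, `L` odd):

* `natAbs_valMinAbs_le_half` (`|v| ≤ (M−1)/2` for odd `M`), `valMinAbs_intCast_of_abs_le`;
* `cubeIndex_spec` (`x_i ∈ [s·b_i − h, s·b_i + h]`, `h = (s−1)/2`), `abs_cubeIndex_le`
  (`|b_i| ≤ (t−1)/2`), `card_filter_cubeIndex_eq` (each fibre of the block index in one coordinate
  has exactly `s` residues);
* **`card_blockOf`** — every block has exactly `s^d` points; **`card_eq_numBlocks_mul`** —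
  `|X| = |X|_k · s^d` for a polymer;
* `supNorm_sub_le_of_sameBlock` (blocks have `dist_∞`-diameter `≤ s − 1`),
  `blockOf_subset_ball` (`B ⊆ y + [−(s−1), s−1]^d` for `y ∈ B`), `blockOf_subset_ball_of_near`
  (a block within `r` of `x` lies in `x + [−(r+s−1), r+s−1]^d` — the box of [ABKM19]'s `χ_X`);
* `IsPolymer.biUnion_blockOf_eq` (`X = ⋃_{x∈X} B_x`), `IsPolymer.thicken_eq_biUnion`
  (`X + Q = ⋃_{x ∈ X} (B_x + Q)`: `X* = ⋃ B*`, `X⁺ = ⋃ B⁺`);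
* `card_image_blockOf_le_numBlocks`, `thicken_blockOf_subset_ball`, **`IsPolymer.card_thicken_le`**
  (`#(X + [−r,r]^d) ≤ |X|_k (2(r+s−1)+1)^d`: the count `|X^{+++}| ≲ L^{kd}|X|_k` of Lemma 7.7 (i)).

Everything is proved; no named fact.

## References
* S. Adams, R. Kotecký, S. Müller, arXiv:1606.09541, Ch. 4 (blocks `𝓑_k`, `|X|_k`) [AdamsKoteckyMuller2016].
* S. Adams, S. Buchholz, R. Kotecký, S. Müller, arXiv:1910.13564, Ch. 6.2, (7.2), Lemma 7.7 (i),
  Lemma 7.8 [AdamsBuchholzKoteckyMuller2019].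
-/

namespace Literature.MathematicalPhysics.StatisticalMechanics.TorusPolymer

open Finset
open Literature.MathematicalPhysics.StatisticalMechanics.GradientFRD
  (supNorm natAbs_valMinAbs_le_supNorm natAbs_valMinAbs_intCast_le)

variable {d M : ℕ}

/-- The sup-norm of `TorusPolymers` is the sup-norm of the finite-range decomposition files
(same definition; bookkeeping). [cite: AdamsKoteckyMuller2016, Ch. 4] -/
theorem supNorm_eq_supNorm (x : Fin d → ZMod M) : TorusPolymer.supNorm x = GradientFRD.supNorm x := rfl

/-! ## Symmetric representatives on an odd torus -/

/-- On an odd torus the symmetric representative satisfies `|v| ≤ (M−1)/2`.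
[cite: AdamsKoteckyMuller2016, Ch. 4] -/
theorem natAbs_valMinAbs_le_half [NeZero M] (hM : Odd M) (v : ZMod M) :
    v.valMinAbs.natAbs ≤ (M - 1) / 2 := by
  have h := ZMod.natAbs_valMinAbs_le v
  obtain ⟨m, rfl⟩ := hM
  omega

/-- An integer of absolute value `≤ (M−1)/2` is its own symmetric representative.
[cite: AdamsKoteckyMuller2016, Ch. 4] -/
theorem valMinAbs_intCast_of_abs_le [NeZero M] {u : ℤ} (hu : |u| ≤ ((M : ℤ) - 1) / 2) :
    ((u : ZMod M)).valMinAbs = u := by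
  rw [ZMod.valMinAbs_spec]
  refine ⟨rfl, ?_, ?_⟩
  · have := neg_abs_le u; omega
  · have := le_abs_self u; omega

/-! ## The block index in one coordinate -/

/-- The block index of a residue: `⌊(v + h)/s⌋`, `h = (s−1)/2` (`cubeIndex` coordinatewise).
[cite: AdamsKoteckyMuller2016, Ch. 4] -/
def resIndex (s : ℕ) (v : ZMod M) : ℤ := (v.valMinAbs + ((s : ℤ) - 1) / 2) / (s : ℤ)

/-- `cubeIndex` is `resIndex` coordinatewise. [cite: AdamsKoteckyMuller2016, Ch. 4] -/
theorem cubeIndex_eq_resIndex (s : ℕ) (x : Fin d → ZMod M) (i : Fin d) :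
    cubeIndex s x i = resIndex s (x i) := rfl

/-- **The residues of block index `b` are exactly those with `v ∈ [s·b − h, s·b + h]`** (`s = 2h+1`).
[cite: AdamsKoteckyMuller2016, Ch. 4] -/
theorem resIndex_eq_iff {s : ℕ} (hs : Odd s) (v : ZMod M) (b : ℤ) :
    resIndex s v = b ↔ (s : ℤ) * b - ((s : ℤ) - 1) / 2 ≤ v.valMinAbs ∧
      v.valMinAbs ≤ (s : ℤ) * b + ((s : ℤ) - 1) / 2 := by
  obtain ⟨h, rfl⟩ := hs
  have hh : (((2 * h + 1 : ℕ) : ℤ) - 1) / 2 = h := by push_cast; omega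
  unfold resIndex
  rw [hh, Int.ediv_eq_iff_of_pos (by positivity)]
  push_cast
  constructor
  · rintro ⟨h1, h2⟩; constructor <;> nlinarith
  · rintro ⟨h1, h2⟩; constructor <;> nlinarith

/-- **The block index ranges over `|b| ≤ (t−1)/2`** on the torus of side `M = s·t` (`s,t` odd).
[cite: AdamsKoteckyMuller2016, Ch. 4] -/
theorem abs_resIndex_le [NeZero M] {s t : ℕ} (hM : M = s * t) (hs : Odd s) (ht : Odd t)
    (v : ZMod M) : |resIndex s v| ≤ ((t : ℤ) - 1) / 2 := by
  have hMo : Odd M := by rw [hM]; exact hs.mul ht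
  have hv := natAbs_valMinAbs_le_half hMo v
  have hspec := (resIndex_eq_iff hs v (resIndex s v)).1 rfl
  obtain ⟨h, rfl⟩ := hs
  obtain ⟨t', rfl⟩ := ht
  have hh : (((2 * h + 1 : ℕ) : ℤ) - 1) / 2 = h := by push_cast; omega
  have ht' : (((2 * t' + 1 : ℕ) : ℤ) - 1) / 2 = t' := by push_cast; omega
  have hMeq : M = 2 * (2 * h * t' + h + t') + 1 := by rw [hM]; ring
  have hv' : v.valMinAbs.natAbs ≤ 2 * h * t' + h + t' := by
    have : (M - 1) / 2 = 2 * h * t' + h + t' := by omega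
    exact this ▸ hv
  rw [hh] at hspec
  rw [ht', abs_le]
  set b := resIndex (2 * h + 1) v
  push_cast at hspec
  have h1 : -((2 * h * t' + h + t' : ℕ) : ℤ) ≤ v.valMinAbs := by omega
  have h2 : v.valMinAbs ≤ ((2 * h * t' + h + t' : ℕ) : ℤ) := by omega
  push_cast at h1 h2
  constructor
  · by_contra hcon
    have hb : b + 1 ≤ -t' := by omega
    have : (2 * (h : ℤ) + 1) * (b + 1) ≤ (2 * h + 1) * (-t') :=
      mul_le_mul_of_nonneg_left hb (by positivity)
    nlinarith
  · by_contra hcon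
    have hb : t' + 1 ≤ b := by omega
    have : (2 * (h : ℤ) + 1) * (t' + 1) ≤ (2 * h + 1) * b :=
      mul_le_mul_of_nonneg_left hb (by positivity)
    nlinarith

/-- **Each fibre of the block index has exactly `s` residues** (`M = s·t`, `s,t` odd).
[cite: AdamsKoteckyMuller2016, Ch. 4] -/
theorem card_filter_resIndex_eq [NeZero M] {s t : ℕ} (hM : M = s * t) (hs : Odd s) (ht : Odd t)
    (v₀ : ZMod M) :
    (univ.filter fun v : ZMod M => resIndex s v = resIndex s v₀).card = s := by
  classical
  have hMo : Odd M := by rw [hM]; exact hs.mul ht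
  set b := resIndex s v₀ with hb
  have hbabs := abs_resIndex_le hM hs ht v₀
  obtain ⟨h, hs'⟩ := hs
  obtain ⟨t', ht''⟩ := ht
  have hh : (((s : ℕ) : ℤ) - 1) / 2 = h := by rw [hs']; push_cast; omega
  have ht' : (((t : ℕ) : ℤ) - 1) / 2 = t' := by rw [ht'']; push_cast; omega
  have hM' : (((M : ℕ) : ℤ) - 1) / 2 = 2 * h * t' + h + t' := by
    have hMeq : ((M : ℕ) : ℤ) = 2 * (2 * h * t' + h + t') + 1 := by
      rw [hM, hs', ht'']; push_cast; ring
    rw [hMeq]; omega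
  rw [ht'] at hbabs
  -- the fibre is the image of the integer interval `[s b − h, s b + h]` under the cast
  have hfib : (univ.filter fun v : ZMod M => resIndex s v = b) =
      (Finset.Icc ((s : ℤ) * b - h) ((s : ℤ) * b + h)).image fun u : ℤ => (u : ZMod M) := by
    ext v
    rw [mem_filter, mem_image, resIndex_eq_iff ⟨h, hs'⟩, hh]
    simp only [mem_univ, true_and, mem_Icc]
    constructor
    · intro hv
      exact ⟨v.valMinAbs, hv, ZMod.coe_valMinAbs v⟩
    · rintro ⟨u, hu, rfl⟩
      have habs : |u| ≤ (((M : ℕ) : ℤ) - 1) / 2 := by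
        rw [hM', abs_le]
        rw [abs_le] at hbabs
        rw [hs'] at hu; push_cast at hu
        constructor
        · have : (2 * (h : ℤ) + 1) * (-t') ≤ (2 * h + 1) * b :=
            mul_le_mul_of_nonneg_left hbabs.1 (by positivity)
          nlinarith
        · have : (2 * (h : ℤ) + 1) * b ≤ (2 * h + 1) * t' :=
            mul_le_mul_of_nonneg_left hbabs.2 (by positivity)
          nlinarith
      rw [valMinAbs_intCast_of_abs_le habs]
      exact hu
  rw [hfib, card_image_of_injOn, Int.card_Icc, hs']
  · push_cast; omega
  · intro u hu u' hu' huu'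
    simp only [coe_Icc, Set.mem_Icc] at hu hu'
    have h1 : ((u : ZMod M)).valMinAbs = ((u' : ZMod M)).valMinAbs := congrArg ZMod.valMinAbs huu'
    rw [abs_le] at hbabs
    rw [hs'] at hu hu'; push_cast at hu hu'
    have hlo : (2 * (h : ℤ) + 1) * (-t') ≤ (2 * h + 1) * b :=
      mul_le_mul_of_nonneg_left hbabs.1 (by positivity)
    have hhi : (2 * (h : ℤ) + 1) * b ≤ (2 * h + 1) * t' :=
      mul_le_mul_of_nonneg_left hbabs.2 (by positivity)
    rwa [valMinAbs_intCast_of_abs_le (by rw [hM', abs_le]; constructor <;> nlinarith),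
      valMinAbs_intCast_of_abs_le (by rw [hM', abs_le]; constructor <;> nlinarith)] at h1

/-! ## Cardinality of blocks and polymers -/

variable [NeZero M]

/-- A block is the product of the fibres of its coordinate indices.
[cite: AdamsKoteckyMuller2016, Ch. 4] -/
theorem blockOf_eq_piFinset (s : ℕ) (x : Fin d → ZMod M) :
    blockOf s x = Fintype.piFinset fun i => univ.filter fun v : ZMod M => resIndex s v = resIndex s (x i) := by
  ext y
  rw [mem_blockOf, Fintype.mem_piFinset]
  simp only [mem_filter, mem_univ, true_and, SameBlock, cubeIndex_eq_resIndex]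
  exact ⟨fun h i => (h i).symm, fun h i => (h i).symm⟩

/-- **Every block has exactly `s^d` points** (`M = s·t`, `s,t` odd; `|B| = L^{kd}`).
[cite: AdamsKoteckyMuller2016, Ch. 4] -/
theorem card_blockOf {s t : ℕ} (hM : M = s * t) (hs : Odd s) (ht : Odd t) (x : Fin d → ZMod M) :
    (blockOf s x).card = s ^ d := by
  rw [blockOf_eq_piFinset, Fintype.card_piFinset]
  simp_rw [card_filter_resIndex_eq hM hs ht]
  rw [prod_const, card_univ, Fintype.card_fin]

/-- The points of a polymer with a given block index form a whole block.
[cite: AdamsKoteckyMuller2016, Ch. 4] -/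
theorem IsPolymer.filter_cubeIndex_eq {s : ℕ} {X : Finset (Fin d → ZMod M)} (hX : IsPolymer s X)
    {x : Fin d → ZMod M} (hx : x ∈ X) :
    (X.filter fun y => (fun i => cubeIndex s y i) = fun i => cubeIndex s x i) = blockOf s x := by
  ext y
  rw [mem_filter, mem_blockOf]
  constructor
  · rintro ⟨-, h⟩; exact fun i => (congrFun h i).symm
  · intro h; exact ⟨hX x hx (mem_blockOf.2 h), funext fun i => (h i).symm⟩

/-- **`|X| = |X|_k · s^d`** for a polymer (`M = s·t`, `s,t` odd). [cite: AdamsKoteckyMuller2016, Ch. 4] -/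
theorem card_eq_numBlocks_mul {s t : ℕ} (hM : M = s * t) (hs : Odd s) (ht : Odd t)
    {X : Finset (Fin d → ZMod M)} (hX : IsPolymer s X) : X.card = numBlocks s X * s ^ d := by
  classical
  rw [numBlocks, card_eq_sum_card_image (fun y => fun i => cubeIndex s y i) X]
  rw [← sum_const_nat (m := s ^ d) (f := fun b => (X.filter fun y => (fun i => cubeIndex s y i) = b).card)]
  intro b hb
  obtain ⟨x, hx, rfl⟩ := mem_image.1 hb
  rw [hX.filter_cubeIndex_eq hx, card_blockOf hM hs ht]

/-! ## Diameter of blocks -/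

omit [NeZero M] in
/-- **Blocks have diameter `≤ s − 1`**: two points with the same block indices are at sup-distance
`≤ s − 1`. [cite: AdamsBuchholzKoteckyMuller2019, Ch. 6.2] -/
theorem supNorm_sub_le_of_sameBlock [NeZero M] {s : ℕ} (hs : Odd s) {y z : Fin d → ZMod M}
    (h : SameBlock s y z) : GradientFRD.supNorm (y - z) ≤ s - 1 := by
  rw [supNorm_le_iff]
  intro i
  have hy := (resIndex_eq_iff hs (y i) _).1 rfl
  have hz := (resIndex_eq_iff hs (z i) _).1 rfl
  have hi : resIndex s (y i) = resIndex s (z i) := h i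
  rw [hi] at hy
  obtain ⟨k, rfl⟩ := hs
  have hh : (((2 * k + 1 : ℕ) : ℤ) - 1) / 2 = k := by push_cast; omega
  rw [hh] at hy hz
  -- `y_i − z_i` is the cast of `valMinAbs y_i − valMinAbs z_i`, of size `≤ 2k = s − 1`
  have hcast : y i - z i = (((y i).valMinAbs - (z i).valMinAbs : ℤ) : ZMod M) := by simp
  have := natAbs_valMinAbs_intCast_le (M := M) ((y i).valMinAbs - (z i).valMinAbs)
  rw [← hcast] at this
  rw [Pi.sub_apply]
  omega

/-- A block lies in the ball of radius `s − 1` about each of its points.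
[cite: AdamsBuchholzKoteckyMuller2019, Ch. 6.2] -/
theorem blockOf_subset_ball {s : ℕ} (hs : Odd s) {x y : Fin d → ZMod M} (hy : y ∈ blockOf s x) :
    blockOf s x ⊆ ball (s - 1) y := fun z hz => by
  rw [mem_ball]
  exact supNorm_sub_le_of_sameBlock hs ((mem_blockOf.1 hz).symm.trans (mem_blockOf.1 hy))

/-- **A block within distance `r` of `x` lies in the box `x + [−(r+s−1), r+s−1]^d`** (for `r = s`:
"`B ⊆ x + [−2L^k,2L^k]^d` whenever `x ∈ B⁺`", the box of `χ_X`).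
[cite: AdamsBuchholzKoteckyMuller2019, Ch. 7.1 (7.2)] -/
theorem blockOf_subset_ball_of_near {s r : ℕ} (hs : Odd s) {x y y' : Fin d → ZMod M}
    (hy' : y' ∈ blockOf s y) (hxy : GradientFRD.supNorm (x - y') ≤ r) : blockOf s y ⊆ ball (r + (s - 1)) x :=
  subset_ball_of_diam (fun _ hb _ hb' =>
    supNorm_sub_le_of_sameBlock hs ((mem_blockOf.1 hb).symm.trans (mem_blockOf.1 hb')))
    ⟨y', hy', hxy⟩ le_rfl

/-! ## Polymers are unions of blocks -/

/-- A polymer is the union of the blocks of its points. [cite: AdamsKoteckyMuller2016, Ch. 4] -/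
theorem IsPolymer.biUnion_blockOf_eq {s : ℕ} {X : Finset (Fin d → ZMod M)} (hX : IsPolymer s X) :
    X.biUnion (blockOf s) = X := by
  ext y
  rw [mem_biUnion]
  exact ⟨fun ⟨x, hx, hy⟩ => hX x hx hy, fun hy => ⟨y, hy, mem_blockOf_self s y⟩⟩

/-- **`X + Q = ⋃_{x∈X} (B_x + Q)`** for a polymer (`X* = ⋃_B B*`, `X⁺ = ⋃_B B⁺`).
[cite: AdamsBuchholzKoteckyMuller2019, Ch. 6.2 (6.24)] -/
theorem IsPolymer.thicken_eq_biUnion {s : ℕ} {X : Finset (Fin d → ZMod M)} (hX : IsPolymer s X)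
    (r : ℕ) : thicken r X = X.biUnion fun x => thicken r (blockOf s x) := by
  conv_lhs => rw [← hX.biUnion_blockOf_eq]
  exact thicken_biUnion r X (blockOf s)

/-- **A polymer meets every box around a point of `X + [−r,r]^d` in a whole block**: for
`x ∈ X + [−r,r]^d` there is a block `B ⊆ X` with `B ⊆ x + [−(r+s−1), r+s−1]^d`
(so `#(X ∩ box) ≥ s^d`: `χ_X ≥ 1` on `X⁺`). [cite: AdamsBuchholzKoteckyMuller2019, Ch. 7.1 (7.2)] -/
theorem IsPolymer.exists_block_subset {s r : ℕ} (hs : Odd s) {X : Finset (Fin d → ZMod M)}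
    (hX : IsPolymer s X) {x : Fin d → ZMod M} (hx : x ∈ thicken r X) :
    ∃ y ∈ X, blockOf s y ⊆ X ∧ blockOf s y ⊆ ball (r + (s - 1)) x := by
  obtain ⟨y, hy, hxy⟩ := mem_thicken.1 hx
  exact ⟨y, hy, hX y hy, blockOf_subset_ball_of_near hs (mem_blockOf_self s y) hxy⟩

/-! ## Counting thickened polymers by blocks -/

/-- A block is the fibre of the block-index vector. [cite: AdamsKoteckyMuller2016, Ch. 4] -/
theorem blockOf_eq_filter_cubeIndex (s : ℕ) (x : Fin d → ZMod M) :
    blockOf s x = univ.filter fun y => (fun i => cubeIndex s y i) = fun i => cubeIndex s x i := by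
  ext y
  rw [mem_blockOf, mem_filter]
  simp only [mem_univ, true_and]
  exact ⟨fun h => funext fun i => (h i).symm, fun h i => (congrFun h i).symm⟩

/-- The number of distinct blocks met by `X` is `|X|_k` (`numBlocks`).
[cite: AdamsKoteckyMuller2016, Ch. 4] -/
theorem card_image_blockOf_le_numBlocks (s : ℕ) (X : Finset (Fin d → ZMod M)) :
    (X.image (blockOf s)).card ≤ numBlocks s X := by
  classical
  rw [numBlocks]
  have h : X.image (blockOf s) = (X.image fun y => fun i => cubeIndex s y i).image
      fun b => univ.filter fun y => (fun i => cubeIndex s y i) = b := by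
    rw [Finset.image_image]
    refine Finset.image_congr fun x _ => ?_
    simp only [Function.comp_apply, blockOf_eq_filter_cubeIndex]
  rw [h]
  exact Finset.card_image_le

/-- A thickened block lies in a ball: `B + [−r,r]^d ⊆ y + [−(r+s−1), r+s−1]^d` for `y ∈ B`.
[cite: AdamsBuchholzKoteckyMuller2019, Lemma 7.7 (i) (|X^{+++}| ≤ (7R+1)^d L^{kd}|X|_k)] -/
theorem thicken_blockOf_subset_ball {s : ℕ} (hs : Odd s) (r : ℕ) (y : Fin d → ZMod M) :
    thicken r (blockOf s y) ⊆ ball (r + (s - 1)) y := by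
  intro z hz
  obtain ⟨x, hx, hzx⟩ := mem_thicken.1 hz
  have hxy := mem_ball.1 (blockOf_subset_ball hs (mem_blockOf_self s y) hx)
  rw [mem_ball]
  have := TorusPolymer.supNorm_sub_le z x y
  omega

/-- **`#(X + [−r,r]^d) ≤ |X|_k · (2(r+s−1)+1)^d`** for an `s`-polymer `X` (each of the `|X|_k`
blocks thickens into a ball of radius `r + s − 1`).
[cite: AdamsBuchholzKoteckyMuller2019, Lemma 7.7 (i) (|X^{+++}| ≤ (7R+1)^d L^{kd}|X|_k)] -/
theorem IsPolymer.card_thicken_le {s : ℕ} (hs : Odd s) {X : Finset (Fin d → ZMod M)}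
    (hX : IsPolymer s X) (r : ℕ) :
    (thicken r X).card ≤ numBlocks s X * (2 * (r + (s - 1)) + 1) ^ d := by
  classical
  rw [hX.thicken_eq_biUnion r, ← Finset.image_biUnion]
  refine Finset.card_biUnion_le.trans ?_
  calc ∑ B ∈ X.image (blockOf s), (thicken r B).card
      ≤ ∑ _B ∈ X.image (blockOf s), (2 * (r + (s - 1)) + 1) ^ d := by
        refine Finset.sum_le_sum fun B hB => ?_
        obtain ⟨y, -, rfl⟩ := Finset.mem_image.1 hB
        exact (Finset.card_le_card (thicken_blockOf_subset_ball hs r y)).trans (card_ball_le _ _)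
    _ = (X.image (blockOf s)).card * (2 * (r + (s - 1)) + 1) ^ d := by
        rw [Finset.sum_const, smul_eq_mul]
    _ ≤ numBlocks s X * (2 * (r + (s - 1)) + 1) ^ d :=
        Nat.mul_le_mul_right _ (card_image_blockOf_le_numBlocks s X)

end Literature.MathematicalPhysics.StatisticalMechanics.TorusPolymer
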